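import Mathlib
import Summits.Ventures.PercRepro2.SwOutAll
import Summits.Ventures.PercRepro2.SwOutCyclicDefs
import Summits.Ventures.PercRepro2.SwOutCyclic

/-!
# Row (SW) on four infinite families: the complete graphs `K_{n+1}`, the wheels `W_{n+2}`, the
subdivided wheels and the wheels with pendant leaves (blind cell PercRepro2, night-4 g10,
2026-08-25; proofs/NIGHT4-G10.md §8)

The first two families have a universal vertex (the apex `0` of `K_{n+1}`, the hub `0` of the
wheel), so row (SW) with `l = 0` follows from Theorem C `sw_of_cyclic` in its degenerate form (every
vertex has an edge to `l`: the arm principle alone, proofs/NIGHT4-G10.md §7) for every choice of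
`h ≠ 0` and every `o`; the rim edges of the wheel play no role. The
subdivided wheel (every rim edge subdivided once) has `n + 2` vertices of degree `2` NOT joined to
the hub: there the full Theorem C (`sw_of_cyclic`, the series reduction) is needed; the wheel with a
pendant leaf at every rim vertex has `n + 2` leaves not joined to the hub (the leaf reduction).
-/

namespace Summit.Ventures.PercRepro2

namespace LocRows

/-- The complete graph `K_{n+1}` on `Fin (n+1)`: the edges are the ordered pairs `a < b`. -/
def completeEnds (n : ℕ) : {p : Fin (n + 1) × Fin (n + 1) // p.1 < p.2} → Sym2 (Fin (n + 1)) :=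
  fun p => s(p.1.1, p.1.2)

/-- **Row (SW) on every complete graph** `K_{n+1}` with the apex `l = 0`, for every `h ≠ 0` and
every `o`. -/
theorem sw_complete (n : ℕ) (h o : Fin (n + 1)) (hh : h ≠ 0) : Sw (completeEnds n) 0 h o := by
  refine sw_of_cyclic (l := 0) (h := h) (o := o) hh.symm _ ?_
  intro x hx _ _
  left
  have hx0 : x ≠ 0 := fun h0 => hx (by simp [h0])
  exact ⟨⟨(0, x), Fin.pos_iff_ne_zero.mpr hx0⟩, 0, by simp [completeEnds, Sym2.eq_swap], by simp⟩

/-- The wheel `W_{n+2}` on `Fin (n+3)`: hub `0`, rim `1, …, n+2`; `inl i` is the spoke to the rim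
vertex `i.succ`, `inr i` the rim edge from `i.succ` to `(i+1).succ`. -/
def wheelEnds (n : ℕ) : Fin (n + 2) ⊕ Fin (n + 2) → Sym2 (Fin (n + 3))
  | Sum.inl i => s(0, i.succ)
  | Sum.inr i => s(i.succ, (i + 1).succ)

/-- **Row (SW) on every wheel** `W_{n+2}` with the hub `l = 0`, for every `h ≠ 0` and every `o`. -/
theorem sw_wheel (n : ℕ) (h o : Fin (n + 3)) (hh : h ≠ 0) : Sw (wheelEnds n) 0 h o := by
  refine sw_of_cyclic (l := 0) (h := h) (o := o) hh.symm _ ?_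
  intro x hx _ _
  left
  have hx0 : x ≠ 0 := fun h0 => hx (by simp [h0])
  exact ⟨Sum.inl (x.pred hx0), 0, by simp [wheelEnds, Sym2.eq_swap], by simp⟩

/-- The subdivided wheel on the vertices `Fin (n+3) ⊕ Fin (n+2)`: hub `inl 0`, rim vertices
`inl i.succ`, and a subdivision vertex `inr i` on the rim edge from `inl i.succ` to
`inl (i+1).succ`. The edges: `inl i` = spoke hub–rim `i`, `inr (inl i)` = rim `i`–subdivision `i`,
`inr (inr i)` = subdivision `i`–rim `i+1`. -/
def subWheelEnds (n : ℕ) : Fin (n + 2) ⊕ (Fin (n + 2) ⊕ Fin (n + 2)) →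
    Sym2 (Fin (n + 3) ⊕ Fin (n + 2))
  | Sum.inl i => s(Sum.inl 0, Sum.inl i.succ)
  | Sum.inr (Sum.inl i) => s(Sum.inl i.succ, Sum.inr i)
  | Sum.inr (Sum.inr i) => s(Sum.inr i, Sum.inl (i + 1).succ)

/-- **Row (SW) on every subdivided wheel** with the hub `l = inl 0`, for every `h ≠ inl 0` and
every `o` — an instance of Theorem C proper: the subdivision vertices are not joined to `l`. -/
theorem sw_subWheel (n : ℕ) (h o : Fin (n + 3) ⊕ Fin (n + 2)) (hh : h ≠ Sum.inl 0) :
    Sw (subWheelEnds n) (Sum.inl 0) h o := by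
  refine sw_of_cyclic (l := Sum.inl 0) (h := h) (o := o) hh.symm _ ?_
  rintro (x | x) hx _ _
  · left
    have hx0 : x ≠ 0 := fun h0 => hx (by simp [h0])
    exact ⟨Sum.inl (x.pred hx0), Sum.inl 0, by simp [subWheelEnds, Sym2.eq_swap], by simp⟩
  · right
    refine ⟨?_, ?_⟩
    · rintro (i | i | i) he y hy
      · simp [subWheelEnds] at he
      · simp only [subWheelEnds, Sym2.mem_iff] at hy
        rcases hy with rfl | rfl <;> simp
      · simp only [subWheelEnds, Sym2.mem_iff] at hy
        rcases hy with rfl | rfl <;> simp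
    · have hsub : edgesAt (subWheelEnds n) (Sum.inr x) ⊆
          {Sum.inr (Sum.inl x), Sum.inr (Sum.inr x)} := by
        rintro (i | i | i) he
        · rw [mem_edgesAt] at he
          simp [subWheelEnds] at he
        · rw [mem_edgesAt] at he
          simp only [subWheelEnds, Sym2.mem_iff, reduceCtorEq, Sum.inr.injEq, false_or] at he
          subst he
          simp
        · rw [mem_edgesAt] at he
          simp only [subWheelEnds, Sym2.mem_iff, reduceCtorEq, Sum.inr.injEq, or_false] at he
          subst he
          simp
      exact (Finset.card_le_card hsub).trans Finset.card_le_two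

/-- The wheel with a pendant leaf at every rim vertex, on the vertices `Fin (n+3) ⊕ Fin (n+2)`: hub
`inl 0`, rim vertices `inl i.succ`, leaves `inr i`. The edges: `inl i` = spoke, `inr (inl i)` = rim
edge from `inl i.succ` to `inl (i+1).succ`, `inr (inr i)` = pendant edge from `inl i.succ` to the
leaf `inr i`. -/
def leafWheelEnds (n : ℕ) : Fin (n + 2) ⊕ (Fin (n + 2) ⊕ Fin (n + 2)) →
    Sym2 (Fin (n + 3) ⊕ Fin (n + 2))
  | Sum.inl i => s(Sum.inl 0, Sum.inl i.succ)
  | Sum.inr (Sum.inl i) => s(Sum.inl i.succ, Sum.inl (i + 1).succ)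
  | Sum.inr (Sum.inr i) => s(Sum.inl i.succ, Sum.inr i)

/-- **Row (SW) on every wheel with pendant leaves** with the hub `l = inl 0`, for every
`h ≠ inl 0` and every `o` — the leaves are not joined to `l` (the leaf reduction of Theorem C). -/
theorem sw_leafWheel (n : ℕ) (h o : Fin (n + 3) ⊕ Fin (n + 2)) (hh : h ≠ Sum.inl 0) :
    Sw (leafWheelEnds n) (Sum.inl 0) h o := by
  refine sw_of_cyclic (l := Sum.inl 0) (h := h) (o := o) hh.symm _ ?_
  rintro (x | x) hx _ _
  · left
    have hx0 : x ≠ 0 := fun h0 => hx (by simp [h0])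
    exact ⟨Sum.inl (x.pred hx0), Sum.inl 0, by simp [leafWheelEnds, Sym2.eq_swap], by simp⟩
  · right
    refine ⟨?_, ?_⟩
    · rintro (i | i | i) he y hy
      · simp [leafWheelEnds] at he
      · simp [leafWheelEnds] at he
      · simp only [leafWheelEnds, Sym2.mem_iff] at hy
        rcases hy with rfl | rfl <;> simp
    · have hsub : edgesAt (leafWheelEnds n) (Sum.inr x) ⊆ {Sum.inr (Sum.inr x)} := by
        rintro (i | i | i) he
        · rw [mem_edgesAt] at he
          simp [leafWheelEnds] at he
        · rw [mem_edgesAt] at he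
          simp [leafWheelEnds] at he
        · rw [mem_edgesAt] at he
          simp only [leafWheelEnds, Sym2.mem_iff, reduceCtorEq, Sum.inr.injEq, false_or] at he
          subst he
          simp
      exact (Finset.card_le_card hsub).trans (by simp)

end LocRows

end Summit.Ventures.PercRepro2
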